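import Literature.Geometry.Kaehler.ComplexTorusDivisorSumDoublePoints
import Literature.Geometry.Kaehler.ComplexTorusBoxDivisorSingularLocus
import HarnessLib

/-!
# `𝒮_dec ⊂ ℋ`: along `Θ₁^{sm} × Θ₂^{sm}` the tangent cone of the theta divisor `Θ₁ × X₂ + X₁ × Θ₂` of a
# decomposable abelian variety is the rank-`2` quadric `T Θ₁ × V₂ ∪ V₁ × T Θ₂` — never an ordinary double
# point when `g ≥ 3`, an ordinary double point on a product of two elliptic curves

[tag: lange-cav-complex-tori] [linked: HodgeConjecture (lit-hodgefound SKELETON §A2, row A2-193)]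

Layer `Literature/Geometry/Kaehler`, namespaces `Literature.Geometry.Kaehler.SCV` (§1) and
`Literature.Geometry.Kaehler.ComplexTorus` (§2); lane `lit-hodgefound` (Track 2 foundations library),
skeleton seat `lit-hodgefound-skel-2` (generation 41), plan row A2-193 = pointer (61) of the gen-41 list:
A2-190 `ComplexTorusDivisorSumDoublePoints` (double points of `D₁ + D₂`) specialised to the box divisor
`pr₁^* D₁ + pr₂^* D₂ = (ϑ₁ ⊠ ϑ₂)` on `X₁ × X₂ = ComplexTorus (prodPeriodL2 Φ₁ Φ₂)` of A2-161/A2-173/A2-176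
(which give the divisor, its multiplicities `mult₁ + mult₂` and `|D₁| × |D₂| ⊆ Sing` as a set). Theorems
only; no definition, no named fact.

Sources, VERBATIM. G. Farkas, S. Grushevsky, R. Salvati Manni, A. Verra, *Singularities of theta divisors
and the geometry of `𝒜₅`* (JEMS 16, 2014) [held `paper:galaxy-pdf-788537660`], p. 8 L4–6: "`S_dec := S ∩
φ⁻¹(𝒜_1 × 𝒜_{g−1})`. Since the theta divisor of a product `(A₁, Θ₁) × (A₂, Θ₂)` is given by the union
`(Θ₁ × A₂) ∪ (A₁ × Θ₂)`, its singular locus contains `Θ₁ × Θ₂` and is of codimension 2"; p. 11 L11: "we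
note that `𝒮_dec ⊂ ℋ ⊂ 𝒮` is an irreducible component of codimension `g + 1`" (`ℋ` = singular points that
are not ordinary double points); p. 1 L13: "ordinary double point (that is, the quadratic tangent cone to
the theta divisor at such a point has maximal rank `g` […])". S. Grushevsky, *The Schottky problem* (2012)
[held `paper:arxiv-1009.0369` p. 11 L13]: "for a decomposable ppav […] `Θ = (Θ₁ × A₂) ∪ (A₁ × Θ₂)`, and
thus `Sing Θ ⊃ Θ₁ × Θ₂` is of dimension `g − 2`." H. Lange, *Abelian Varieties over the Complex Numbers*
(2023), §5.1 Lemma 5.1.1 (the divisors `Θ₁ × X₂ + X₁ × D`), §2.1.6 Exercise (7) (p. 88). R. Hartshorne,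
*Algebraic Geometry* (1977), I Ex. 5.6 (b) [chunk p0053]: "a node (also called ordinary double point)
[is] a double point […] with distinct tangent directions".

Dictionary. `V = V₁ × V₂` (Euclidean presentation `WithLp 2 (E₁ × E₂)`), `pr_i` the projections,
`ϑ₁ ⊠ ϑ₂ (z) = ϑ₁(z₁) ϑ₂(z₂) = (ϑ₁ ∘ pr₁)(ϑ₂ ∘ pr₂)`, `(ϑ₁ ⊠ ϑ₂) = pr₁^*(ϑ₁) + pr₂^*(ϑ₂)` (A2-161
`divisorChain_boxMul`); at `z` with `mult_{π₁ z₁}(D₁) = mult_{π₂ z₂}(D₂) = 1` the two branches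
`pr₁^* D₁ ⊇ D₁ × X₂`, `pr₂^* D₂` are smooth with tangent hyperplanes `T_{z₁}D₁ × V₂ ≠ V₁ × T_{z₂}D₂`
(always transversal).

## Contents

* §1 SCV on `V₁ × V₂`: `fderiv_comp_fst_ofLp_apply` / `snd` (`d(f ∘ pr₁)(z)(w) = df(z₁)(w₁)`),
  `differentiable_comp_fst_ofLp` / `snd`, **`ker_fderiv_comp_fst_ne_ker_fderiv_comp_snd`** (the two tangent
  hyperplanes are distinct as soon as `df(z₁) ≠ 0`), `pointOrder_boxMul_eq_two`,
  **`hessianRank_boxMul_eq_two`** (`rk D²(ϑ₁ ⊠ ϑ₂)(z) = 2` at a point of `Z₁^{sm} × Z₂^{sm}`),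
  `ker_fderiv_fderiv_boxMul` (vertex `= Ker df(z₁) × Ker dg(z₂)`).
* §2 complex tori `X₁ × X₂`: `divisorMultAt_boxDivisor_eq_two` (`mult = 2` on `D₁^{sm} × D₂^{sm}`),
  **`hessianRank_boxMul_thetaFunctions_eq_two`** (the tangent cone there is a rank-`2` quadric),
  **`hessianRank_boxMul_thetaFunctions_lt_finrank`** (`g = g₁ + g₂ ≥ 3` ⇒ NOT an ordinary double point —
  "`𝒮_dec ⊂ ℋ`"), `hessianRank_boxMul_thetaFunctions_eq_finrank` (`g₁ = g₂ = 1`: a product of elliptic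
  curves, `E₁ × {x₂} + {x₁} × E₂` has an ordinary double point at `(x₁, x₂)`).

## References

* [FarkasGrushevskySalvatiManniVerra2014] G. Farkas, S. Grushevsky, R. Salvati Manni, A. Verra, JEMS 16
  (2014), p. 1 L13, p. 8 L4–6 (`S_dec`), p. 11 L11 (`𝒮_dec ⊂ ℋ`).
* [Grushevsky2012SchottkyProblem] S. Grushevsky, *The Schottky problem* (2012), §5 (p. 11 L13).
* [Lange2023AbelianVarietiesComplex] H. Lange (2023), §5.1 Lemma 5.1.1, §2.1.6 Exercise (7) (p. 88).
* [Hartshorne1977] R. Hartshorne, *Algebraic Geometry* (1977), I Ex. 5.6 (b) (p0053).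
* [Fulton1998] W. Fulton, *Intersection Theory* (1998), §1.7 Prop. 1.7 (orders under flat pullback).
-/

noncomputable section

open scoped Manifold Topology
open Set Function Module Filter WithLp

namespace Literature.Geometry.Kaehler

universe u

namespace SCV

/-! ### §1 `V₁ × V₂`: the two pulled-back branches are transversal -/

section Prod

variable {V₁ V₂ : Type*} [NormedAddCommGroup V₁] [NormedSpace ℂ V₁] [NormedAddCommGroup V₂] [NormedSpace ℂ V₂]

/-- `d(f ∘ pr₁)(z)(w) = df(z₁)(w₁)`. [cite: Fulton1998, §1.7 Prop. 1.7] [cite: Chirka1989, §1.5 (p. 10)] -/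
theorem fderiv_comp_fst_ofLp_apply {f : V₁ → ℂ} (hf : Differentiable ℂ f) (z w : WithLp 2 (V₁ × V₂)) :
    fderiv ℂ (fun u : WithLp 2 (V₁ × V₂) => f (ofLp u).1) z w = fderiv ℂ f (ofLp z).1 (ofLp w).1 := by
  set P : WithLp 2 (V₁ × V₂) →L[ℂ] V₁ := (ContinuousLinearMap.fst ℂ V₁ V₂).comp
    (WithLp.prodContinuousLinearEquiv 2 ℂ V₁ V₂ : WithLp 2 (V₁ × V₂) →L[ℂ] (V₁ × V₂)) with hP
  have h := ((hf (P z)).hasFDerivAt.comp z P.hasFDerivAt).fderiv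
  have hfun : (f ∘ ⇑P) = fun u : WithLp 2 (V₁ × V₂) => f (ofLp u).1 := rfl
  rw [hfun] at h
  rw [h]
  rfl

/-- `d(g ∘ pr₂)(z)(w) = dg(z₂)(w₂)`. [cite: Fulton1998, §1.7 Prop. 1.7] [cite: Chirka1989, §1.5 (p. 10)] -/
theorem fderiv_comp_snd_ofLp_apply {g : V₂ → ℂ} (hg : Differentiable ℂ g) (z w : WithLp 2 (V₁ × V₂)) :
    fderiv ℂ (fun u : WithLp 2 (V₁ × V₂) => g (ofLp u).2) z w = fderiv ℂ g (ofLp z).2 (ofLp w).2 := by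
  set P : WithLp 2 (V₁ × V₂) →L[ℂ] V₂ := (ContinuousLinearMap.snd ℂ V₁ V₂).comp
    (WithLp.prodContinuousLinearEquiv 2 ℂ V₁ V₂ : WithLp 2 (V₁ × V₂) →L[ℂ] (V₁ × V₂)) with hP
  have h := ((hg (P z)).hasFDerivAt.comp z P.hasFDerivAt).fderiv
  have hfun : (g ∘ ⇑P) = fun u : WithLp 2 (V₁ × V₂) => g (ofLp u).2 := rfl
  rw [hfun] at h
  rw [h]
  rfl

/-- `f ∘ pr₁` is entire. [cite: Chirka1989, §1.5 (p. 10)] -/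
theorem differentiable_comp_fst_ofLp {f : V₁ → ℂ} (hf : Differentiable ℂ f) :
    Differentiable ℂ fun u : WithLp 2 (V₁ × V₂) => f (ofLp u).1 :=
  hf.comp ((ContinuousLinearMap.fst ℂ V₁ V₂).comp
    (WithLp.prodContinuousLinearEquiv 2 ℂ V₁ V₂ : WithLp 2 (V₁ × V₂) →L[ℂ] (V₁ × V₂))).differentiable

/-- `g ∘ pr₂` is entire. [cite: Chirka1989, §1.5 (p. 10)] -/
theorem differentiable_comp_snd_ofLp {g : V₂ → ℂ} (hg : Differentiable ℂ g) :
    Differentiable ℂ fun u : WithLp 2 (V₁ × V₂) => g (ofLp u).2 :=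
  hg.comp ((ContinuousLinearMap.snd ℂ V₁ V₂).comp
    (WithLp.prodContinuousLinearEquiv 2 ℂ V₁ V₂ : WithLp 2 (V₁ × V₂) →L[ℂ] (V₁ × V₂))).differentiable

/-- **The tangent hyperplanes `Ker d(f ∘ pr₁)(z) = T_{z₁} × V₂` and `Ker d(g ∘ pr₂)(z) = V₁ × T_{z₂}` are
DISTINCT** as soon as `df(z₁) ≠ 0` (the vector `(u₁, 0)` with `df(z₁)u₁ ≠ 0` lies in the second but not
in the first): the two branches of `D₁ × X₂ + X₁ × D₂` always meet transversally.
[cite: Hartshorne1977, I Ex. 5.6 (b) (p0053: "distinct tangent directions")] [cite: Grushevsky2012SchottkyProblem, §5 (p. 11 L13)] -/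
theorem ker_fderiv_comp_fst_ne_ker_fderiv_comp_snd {f : V₁ → ℂ} {g : V₂ → ℂ} (hf : Differentiable ℂ f)
    (hg : Differentiable ℂ g) {z : WithLp 2 (V₁ × V₂)} (hdf : fderiv ℂ f (ofLp z).1 ≠ 0) :
    LinearMap.ker ((fderiv ℂ (fun u : WithLp 2 (V₁ × V₂) => f (ofLp u).1) z : WithLp 2 (V₁ × V₂) →L[ℂ] ℂ) :
        WithLp 2 (V₁ × V₂) →ₗ[ℂ] ℂ) ≠
      LinearMap.ker ((fderiv ℂ (fun u : WithLp 2 (V₁ × V₂) => g (ofLp u).2) z : WithLp 2 (V₁ × V₂) →L[ℂ] ℂ) :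
        WithLp 2 (V₁ × V₂) →ₗ[ℂ] ℂ) := by
  obtain ⟨u₁, hu₁⟩ : ∃ u₁, fderiv ℂ f (ofLp z).1 u₁ ≠ 0 := by
    by_contra hc
    push Not at hc
    exact hdf (ContinuousLinearMap.ext fun u => by rw [hc u]; rfl)
  intro heq
  have hmem : toLp 2 (u₁, (0 : V₂)) ∈ LinearMap.ker ((fderiv ℂ (fun u : WithLp 2 (V₁ × V₂) => g (ofLp u).2) z :
      WithLp 2 (V₁ × V₂) →L[ℂ] ℂ) : WithLp 2 (V₁ × V₂) →ₗ[ℂ] ℂ) := by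
    rw [LinearMap.mem_ker, ContinuousLinearMap.coe_coe, fderiv_comp_snd_ofLp_apply hg]
    simp
  rw [← heq, LinearMap.mem_ker, ContinuousLinearMap.coe_coe, fderiv_comp_fst_ofLp_apply hf] at hmem
  exact hu₁ (by simpa using hmem)

/-- `ord_z(ϑ₁ ⊠ ϑ₂) = 2` at a point of `Z₁^{sm} × Z₂^{sm}`. [cite: Lange2023AbelianVarietiesComplex, §2.1.6 Exercise (7) (p. 88)] [cite: Chirka1989, §1.5 Prop. 1 (p. 11)] -/
theorem pointOrder_boxMul_eq_two {f : V₁ → ℂ} {g : V₂ → ℂ} (hf : Differentiable ℂ f) (hg : Differentiable ℂ g)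
    {z : WithLp 2 (V₁ × V₂)} (h1f : pointOrder f (ofLp z).1 = 1) (h1g : pointOrder g (ofLp z).2 = 1) :
    pointOrder (fun u : WithLp 2 (V₁ × V₂) => f (ofLp u).1 * g (ofLp u).2) z = 2 := by
  have h := pointOrder_mul_eq_two (differentiable_comp_fst_ofLp (V₂ := V₂) hf)
    (differentiable_comp_snd_ofLp (V₁ := V₁) hg) (v := z)
    (by rw [pointOrder_comp_fst_ofLp, h1f]) (by rw [pointOrder_comp_snd_ofLp, h1g])
  exact h

/-- **`rk D²(ϑ₁ ⊠ ϑ₂)(z) = 2` AT A POINT OF `Z₁^{sm} × Z₂^{sm}`**: the tangent cone of `Z(ϑ₁ ⊠ ϑ₂) =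
Z₁ × V₂ ∪ V₁ × Z₂` there is the pair of transversal hyperplanes `T_{z₁}Z₁ × V₂`, `V₁ × T_{z₂}Z₂`.
[cite: FarkasGrushevskySalvatiManniVerra2014, p. 8 L4–6 and p. 11 L11 ("`𝒮_dec ⊂ ℋ`")] [cite: Hartshorne1977, I Ex. 5.6 (b) (p0053)] -/
theorem hessianRank_boxMul_eq_two [FiniteDimensional ℂ V₁] [FiniteDimensional ℂ V₂] {f : V₁ → ℂ} {g : V₂ → ℂ}
    (hf : Differentiable ℂ f) (hg : Differentiable ℂ g) {z : WithLp 2 (V₁ × V₂)}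
    (h1f : pointOrder f (ofLp z).1 = 1) (h1g : pointOrder g (ofLp z).2 = 1) :
    hessianRank (fun u : WithLp 2 (V₁ × V₂) => f (ofLp u).1 * g (ofLp u).2) z = 2 :=
  (hessianRank_mul_eq_two_iff (differentiable_comp_fst_ofLp (V₂ := V₂) hf)
    (differentiable_comp_snd_ofLp (V₁ := V₁) hg) (v := z)
    (by rw [pointOrder_comp_fst_ofLp, h1f]) (by rw [pointOrder_comp_snd_ofLp, h1g])).2
    (ker_fderiv_comp_fst_ne_ker_fderiv_comp_snd hf hg (fderiv_ne_zero_of_pointOrder_eq_one hf h1f))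

/-- The vertex of that tangent cone is `T_{z₁}Z₁ × T_{z₂}Z₂ = Ker d(f∘pr₁)(z) ∩ Ker d(g∘pr₂)(z)`.
[cite: Grushevsky2012SchottkyProblem, §5 (p. 11 L13: "`Sing Θ ⊃ Θ₁ × Θ₂`")] [cite: Hartshorne1977, I Ex. 5.6 (b) (p0053)] -/
theorem ker_fderiv_fderiv_boxMul {f : V₁ → ℂ} {g : V₂ → ℂ} (hf : Differentiable ℂ f) (hg : Differentiable ℂ g)
    {z : WithLp 2 (V₁ × V₂)} (h1f : pointOrder f (ofLp z).1 = 1) (h1g : pointOrder g (ofLp z).2 = 1) :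
    LinearMap.ker ((fderiv ℂ (fderiv ℂ (fun u : WithLp 2 (V₁ × V₂) => f (ofLp u).1 * g (ofLp u).2)) z :
        WithLp 2 (V₁ × V₂) →L[ℂ] (WithLp 2 (V₁ × V₂) →L[ℂ] ℂ)) :
          WithLp 2 (V₁ × V₂) →ₗ[ℂ] (WithLp 2 (V₁ × V₂) →L[ℂ] ℂ)) =
      LinearMap.ker ((fderiv ℂ (fun u : WithLp 2 (V₁ × V₂) => f (ofLp u).1) z : WithLp 2 (V₁ × V₂) →L[ℂ] ℂ) :
          WithLp 2 (V₁ × V₂) →ₗ[ℂ] ℂ) ⊓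
        LinearMap.ker ((fderiv ℂ (fun u : WithLp 2 (V₁ × V₂) => g (ofLp u).2) z : WithLp 2 (V₁ × V₂) →L[ℂ] ℂ) :
          WithLp 2 (V₁ × V₂) →ₗ[ℂ] ℂ) :=
  ker_fderiv_fderiv_mul (differentiable_comp_fst_ofLp (V₂ := V₂) hf)
    (differentiable_comp_snd_ofLp (V₁ := V₁) hg) (v := z)
    (by rw [pointOrder_comp_fst_ofLp, h1f]) (by rw [pointOrder_comp_snd_ofLp, h1g])

end Prod

end SCV

/-! ### §2 Complex tori: the theta divisor of a decomposable abelian variety along `Θ₁^{sm} × Θ₂^{sm}` -/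

namespace ComplexTorus

section BoxProduct

variable {ι₁ ι₂ : Type*} [Fintype ι₁] [Fintype ι₂] [DecidableEq ι₁] [DecidableEq ι₂] {E₁ E₂ : Type u}
  [NormedAddCommGroup E₁] [InnerProductSpace ℂ E₁] [FiniteDimensional ℂ E₁]
  [NormedAddCommGroup E₂] [InnerProductSpace ℂ E₂] [FiniteDimensional ℂ E₂]
  {Φ₁ : (ι₁ → ℝ) ≃L[ℝ] E₁} {Φ₂ : (ι₂ → ℝ) ≃L[ℝ] E₂} {d₁ d₂ : ℕ} {n₁ n₂ : ℕ}
  (e₁ : Fin n₁ ≃ ι₁) (e₂ : Fin n₂ ≃ ι₂) (h₁ : 2 * d₁ + 2 = n₁) (h₂ : 2 * d₂ + 2 = n₂)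
  {η₁ : E₁ [⋀^Fin 2]→L[ℝ] ℝ} {η₂ : E₂ [⋀^Fin 2]→L[ℝ] ℝ} {χ₁ : (ι₁ → ℤ) → ℂ} {χ₂ : (ι₂ → ℤ) → ℂ}

include e₁ e₂ h₁ h₂ in
/-- **`mult_{(x₁,x₂)}(D₁ × X₂ + X₁ × D₂) = 2` on `D₁^{sm} × D₂^{sm}`** (`mult₁ + mult₂`, A2-173).
[cite: Grushevsky2012SchottkyProblem, §5 (p. 11 L13: "`Sing Θ ⊃ Θ₁ × Θ₂`")] [cite: Lange2023AbelianVarietiesComplex, §5.1 Lemma 5.1.1 and §2.1.6 Exercise (7) (p. 88)] -/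
theorem divisorMultAt_boxDivisor_eq_two (hη₁ : IsNSForm Φ₁ η₁) (hχ₁ : IsSemicharacter Φ₁ η₁ χ₁)
    (hη₂ : IsNSForm Φ₂ η₂) (hχ₂ : IsSemicharacter Φ₂ η₂ χ₂)
    {D₁ : HolomorphicChain 𝓘(ℂ, E₁) (ComplexTorus Φ₁) d₁} (hD₁ : D₁ ∈ linearSystem Φ₁ d₁ η₁ χ₁)
    {D₂ : HolomorphicChain 𝓘(ℂ, E₂) (ComplexTorus Φ₂) d₂} (hD₂ : D₂ ∈ linearSystem Φ₂ d₂ η₂ χ₂)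
    {z : WithLp 2 (E₁ × E₂)} (h1 : divisorMultAt Φ₁ d₁ D₁ (cover Φ₁ (ofLp z).1) = 1)
    (h2 : divisorMultAt Φ₂ d₂ D₂ (cover Φ₂ (ofLp z).2) = 1) :
    divisorMultAt (prodPeriodL2 Φ₁ Φ₂) (d₁ + d₂ + 1)
        (fstPullbackChain Φ₁ Φ₂ e₂ h₂ D₁ + sndPullbackChain Φ₁ Φ₂ e₁ h₁ D₂) (cover (prodPeriodL2 Φ₁ Φ₂) z) = 2 := by
  rw [divisorMultAt_fstPullbackChain_add_sndPullbackChain_cover e₁ e₂ h₁ h₂ hη₁ hχ₁ hη₂ hχ₂ hD₁ hD₂ z, h1, h2]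
  rfl

omit [DecidableEq ι₁] [DecidableEq ι₂] in
include e₁ e₂ h₁ h₂ in
/-- **THE TANGENT CONE OF `Θ₁ × X₂ + X₁ × Θ₂` AT A POINT OF `Θ₁^{sm} × Θ₂^{sm}` IS A RANK-`2` QUADRIC** (the
pair of transversal hyperplanes `T Θ₁ × V₂`, `V₁ × T Θ₂`; `D_i = (ϑ_i)`, the box divisor is `(ϑ₁ ⊠ ϑ₂)`,
A2-161 `divisorChain_boxMul`). [cite: FarkasGrushevskySalvatiManniVerra2014, p. 8 L4–6 ("its singular locus contains `Θ₁ × Θ₂`") and p. 11 L11 ("`𝒮_dec ⊂ ℋ`")] [cite: Grushevsky2012SchottkyProblem, §5 (p. 11 L13) and Thm. 5.6 (p. 11)] -/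
theorem hessianRank_boxMul_thetaFunctions_eq_two (hη₁ : IsNSForm Φ₁ η₁) (hχ₁ : IsSemicharacter Φ₁ η₁ χ₁)
    (hη₂ : IsNSForm Φ₂ η₂) (hχ₂ : IsSemicharacter Φ₂ η₂ χ₂) {ϑ₁ : E₁ → ℂ} {ϑ₂ : E₂ → ℂ}
    (hϑ₁ : ϑ₁ ∈ thetaFunctions Φ₁ (canonicalFactor Φ₁ η₁ χ₁)) (hϑ₁0 : ϑ₁ ≠ 0)
    (hϑ₂ : ϑ₂ ∈ thetaFunctions Φ₂ (canonicalFactor Φ₂ η₂ χ₂)) (hϑ₂0 : ϑ₂ ≠ 0) {z : WithLp 2 (E₁ × E₂)}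
    (h1 : divisorMultAt Φ₁ d₁ (divisorChain Φ₁ d₁ ϑ₁) (cover Φ₁ (ofLp z).1) = 1)
    (h2 : divisorMultAt Φ₂ d₂ (divisorChain Φ₂ d₂ ϑ₂) (cover Φ₂ (ofLp z).2) = 1) :
    SCV.hessianRank (fun u : WithLp 2 (E₁ × E₂) => ϑ₁ (ofLp u).1 * ϑ₂ (ofLp u).2) z = 2 := by
  rw [divisorMultAt_divisorChain_cover e₁ h₁ hη₁ hχ₁ hϑ₁ hϑ₁0] at h1
  rw [divisorMultAt_divisorChain_cover e₂ h₂ hη₂ hχ₂ hϑ₂ hϑ₂0] at h2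
  exact SCV.hessianRank_boxMul_eq_two (mem_thetaFunctions_iff.1 hϑ₁).1 (mem_thetaFunctions_iff.1 hϑ₂).1 h1 h2

omit [DecidableEq ι₁] [DecidableEq ι₂] in
include e₁ e₂ h₁ h₂ in
/-- **"`𝒮_dec ⊂ ℋ`": for `g = g₁ + g₂ ≥ 3` the double points of `Θ₁ × X₂ + X₁ × Θ₂` along `Θ₁^{sm} × Θ₂^{sm}`
are NOT ordinary double points** (`rk = 2 < g`). [cite: FarkasGrushevskySalvatiManniVerra2014, p. 11 L11 ("`𝒮_dec ⊂ ℋ ⊂ 𝒮` is an irreducible component of codimension `g + 1`") and p. 1 L13 ("maximal rank `g`")] [cite: Grushevsky2012SchottkyProblem, §5 Thm. 5.6 (p. 11: "ordinary (i.e. the tangent cone does not have maximal rank)" negated)] -/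
theorem hessianRank_boxMul_thetaFunctions_lt_finrank (hη₁ : IsNSForm Φ₁ η₁) (hχ₁ : IsSemicharacter Φ₁ η₁ χ₁)
    (hη₂ : IsNSForm Φ₂ η₂) (hχ₂ : IsSemicharacter Φ₂ η₂ χ₂) {ϑ₁ : E₁ → ℂ} {ϑ₂ : E₂ → ℂ}
    (hϑ₁ : ϑ₁ ∈ thetaFunctions Φ₁ (canonicalFactor Φ₁ η₁ χ₁)) (hϑ₁0 : ϑ₁ ≠ 0)
    (hϑ₂ : ϑ₂ ∈ thetaFunctions Φ₂ (canonicalFactor Φ₂ η₂ χ₂)) (hϑ₂0 : ϑ₂ ≠ 0) {z : WithLp 2 (E₁ × E₂)}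
    (h1 : divisorMultAt Φ₁ d₁ (divisorChain Φ₁ d₁ ϑ₁) (cover Φ₁ (ofLp z).1) = 1)
    (h2 : divisorMultAt Φ₂ d₂ (divisorChain Φ₂ d₂ ϑ₂) (cover Φ₂ (ofLp z).2) = 1) (hg : 3 ≤ d₁ + d₂ + 2) :
    SCV.hessianRank (fun u : WithLp 2 (E₁ × E₂) => ϑ₁ (ofLp u).1 * ϑ₂ (ofLp u).2) z <
      finrank ℂ (WithLp 2 (E₁ × E₂)) := by
  rw [hessianRank_boxMul_thetaFunctions_eq_two e₁ e₂ h₁ h₂ hη₁ hχ₁ hη₂ hχ₂ hϑ₁ hϑ₁0 hϑ₂ hϑ₂0 h1 h2,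
    finrank_prodL2_eq Φ₁ Φ₂ e₁ e₂ h₁ h₂]
  omega

omit [DecidableEq ι₁] [DecidableEq ι₂] in
include e₁ e₂ h₁ h₂ in
/-- **A product of two elliptic curves (`g₁ = g₂ = 1`): the double point of `E₁ × {x₂} + {x₁} × E₂` at
`(x₁, x₂)` IS an ordinary double point** (`rk = 2 = g` — Hartshorne's node).
[cite: Hartshorne1977, I Ex. 5.6 (b) (p0053)] [cite: FarkasGrushevskySalvatiManniVerra2014, p. 1 L13] -/
theorem hessianRank_boxMul_thetaFunctions_eq_finrank (hη₁ : IsNSForm Φ₁ η₁) (hχ₁ : IsSemicharacter Φ₁ η₁ χ₁)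
    (hη₂ : IsNSForm Φ₂ η₂) (hχ₂ : IsSemicharacter Φ₂ η₂ χ₂) {ϑ₁ : E₁ → ℂ} {ϑ₂ : E₂ → ℂ}
    (hϑ₁ : ϑ₁ ∈ thetaFunctions Φ₁ (canonicalFactor Φ₁ η₁ χ₁)) (hϑ₁0 : ϑ₁ ≠ 0)
    (hϑ₂ : ϑ₂ ∈ thetaFunctions Φ₂ (canonicalFactor Φ₂ η₂ χ₂)) (hϑ₂0 : ϑ₂ ≠ 0) {z : WithLp 2 (E₁ × E₂)}
    (h1 : divisorMultAt Φ₁ d₁ (divisorChain Φ₁ d₁ ϑ₁) (cover Φ₁ (ofLp z).1) = 1)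
    (h2 : divisorMultAt Φ₂ d₂ (divisorChain Φ₂ d₂ ϑ₂) (cover Φ₂ (ofLp z).2) = 1) (hd₁ : d₁ = 0) (hd₂ : d₂ = 0) :
    SCV.hessianRank (fun u : WithLp 2 (E₁ × E₂) => ϑ₁ (ofLp u).1 * ϑ₂ (ofLp u).2) z =
      finrank ℂ (WithLp 2 (E₁ × E₂)) := by
  rw [hessianRank_boxMul_thetaFunctions_eq_two e₁ e₂ h₁ h₂ hη₁ hχ₁ hη₂ hχ₂ hϑ₁ hϑ₁0 hϑ₂ hϑ₂0 h1 h2,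
    finrank_prodL2_eq Φ₁ Φ₂ e₁ e₂ h₁ h₂, hd₁, hd₂]

include e₁ e₂ h₁ h₂ in
/-- The divisor form: `(ϑ₁ ⊠ ϑ₂) = pr₁^*(ϑ₁) + pr₂^*(ϑ₂)` has multiplicity `2` and a rank-`2` tangent cone
at every point of `(ϑ₁)^{sm} × (ϑ₂)^{sm}`. [cite: Lange2023AbelianVarietiesComplex, §5.1 Lemma 5.1.1 and §2.1.6 Exercise (7) (p. 88)] [cite: FarkasGrushevskySalvatiManniVerra2014, p. 8 L4–6] -/
theorem divisorMultAt_boxMul_eq_two_and_hessianRank_eq_two (hη₁ : IsNSForm Φ₁ η₁)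
    (hχ₁ : IsSemicharacter Φ₁ η₁ χ₁) (hη₂ : IsNSForm Φ₂ η₂) (hχ₂ : IsSemicharacter Φ₂ η₂ χ₂)
    {ϑ₁ : E₁ → ℂ} {ϑ₂ : E₂ → ℂ} (hϑ₁ : ϑ₁ ∈ thetaFunctions Φ₁ (canonicalFactor Φ₁ η₁ χ₁)) (hϑ₁0 : ϑ₁ ≠ 0)
    (hϑ₂ : ϑ₂ ∈ thetaFunctions Φ₂ (canonicalFactor Φ₂ η₂ χ₂)) (hϑ₂0 : ϑ₂ ≠ 0) {z : WithLp 2 (E₁ × E₂)}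
    (h1 : divisorMultAt Φ₁ d₁ (divisorChain Φ₁ d₁ ϑ₁) (cover Φ₁ (ofLp z).1) = 1)
    (h2 : divisorMultAt Φ₂ d₂ (divisorChain Φ₂ d₂ ϑ₂) (cover Φ₂ (ofLp z).2) = 1) :
    divisorMultAt (prodPeriodL2 Φ₁ Φ₂) (d₁ + d₂ + 1)
          (divisorChain (prodPeriodL2 Φ₁ Φ₂) (d₁ + d₂ + 1)
            (fun u : WithLp 2 (E₁ × E₂) => ϑ₁ (ofLp u).1 * ϑ₂ (ofLp u).2))
          (cover (prodPeriodL2 Φ₁ Φ₂) z) = 2 ∧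
      SCV.hessianRank (fun u : WithLp 2 (E₁ × E₂) => ϑ₁ (ofLp u).1 * ϑ₂ (ofLp u).2) z = 2 := by
  refine ⟨?_, hessianRank_boxMul_thetaFunctions_eq_two e₁ e₂ h₁ h₂ hη₁ hχ₁ hη₂ hχ₂ hϑ₁ hϑ₁0 hϑ₂ hϑ₂0 h1 h2⟩
  rw [divisorChain_boxMul Φ₁ Φ₂ e₁ e₂ h₁ h₂ hη₁ hχ₁ hη₂ hχ₂ hϑ₁ hϑ₁0 hϑ₂ hϑ₂0]
  exact divisorMultAt_boxDivisor_eq_two e₁ e₂ h₁ h₂ hη₁ hχ₁ hη₂ hχ₂ ⟨ϑ₁, hϑ₁, hϑ₁0, rfl⟩ ⟨ϑ₂, hϑ₂, hϑ₂0, rfl⟩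
    h1 h2

end BoxProduct

end ComplexTorus

end Literature.Geometry.Kaehler
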